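import Literature.Probability.LatticeModels.MarkovWindowDensity
import HarnessLib

/-!
# The Markov property of the stationary Markov chain of a transfer kernel (window form)

Topic `Literature/Probability/LatticeModels`; theorems only (no definitions, no named facts).
Companion of `MarkovWindowDensity.lean` / `MarkovChainMeasure.lean`: a probability measure `μ`
on `ℤ → S` whose window marginals have the densities
`D a n σ = φ(σ_a) φ(σ_{a+n}) ∏ (k L⁻¹) ∏ w` of a symmetric transfer kernel `k` with pointwise
eigenfunction `φ`, eigenvalue `L` and one-site weight `w` (hypotheses `heig`, `hD`, and the window
formula `hμ : ∫⁻ Φ dμ = (∫⋯∫⁻_{a,…,a+n} Φ · D a n)(η)`) is the two-sided stationary Markov chain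
with one-site law `π = φ² w dν` and transition density `p(x, y) = φ(x)⁻¹ L⁻¹ k(x, y) φ(y) w(y)`
(w.r.t. `ν`). This file PROVES, in `ℝ≥0∞` / `lintegral` form and for observables of finite
windows, the one-site marginal and the Markov property (no conditional expectations are
introduced; the transition density `p` is, like `D`, a variable constrained by a hypothesis `hp`):

* `lintegral_comp_eval_eq` — one-site marginal: `∫⁻ v(σ_b) dμ = ∫⁻ v φ² w dν`;
* `windowDensity_succ_update` — `D a (m+1) (σ with σ_{a+m+1} = y) = D a m σ · p(σ_{a+m}, y)`;
* `measurable_transition`, `measurable_markovOp_iterate`, `lintegral_transition_eq_one`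
  (`∫⁻ p(x, y) dν(y) = 1`);
* `lintegral_mul_comp_eval_succ` — **Markov property, one step**: for `Φ` depending on
  `{a, …, a+m}`, `∫⁻ Φ(σ) v(σ_{a+m+1}) dμ = ∫⁻ Φ(σ) (Pv)(σ_{a+m}) dμ`, `(Pv)(x) = ∫⁻ p(x,y) v(y) dν`;
* `lintegral_mul_comp_eval_add` — iterated: `∫⁻ Φ(σ) v(σ_{a+m+n}) dμ = ∫⁻ Φ(σ) (Pⁿv)(σ_{a+m}) dμ`.

The conditioning of a future window observable on the present spin is in
`MarkovChainConditioning.lean`. [cite: Georgii2011, Thm 10.25 and §11.1]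
-/

noncomputable section

open MeasureTheory Set Function Finset
open scoped ENNReal

namespace Literature.Probability.LatticeModels

variable {S : Type*} [MeasurableSpace S] {ν : Measure S}

section Chain

variable {k : S → S → ℝ≥0∞} {φ w : S → ℝ≥0∞} {L : ℝ≥0∞} {D : ℤ → ℕ → (ℤ → S) → ℝ≥0∞}
  {p : S → S → ℝ≥0∞} {μ : Measure (ℤ → S)}

/-! ### One-site marginal -/

/-- **One-site marginal of the chain**: `∫⁻ v(σ_b) dμ = ∫⁻ v(y) φ(y)² w(y) dν(y)`.
[cite: Georgii2011, Thm 10.25 and §11.1] -/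
theorem lintegral_comp_eval_eq [Nonempty S]
    (hD : ∀ a n σ, D a n σ = φ (σ a) * φ (σ (a + n)) *
      (∏ j ∈ Finset.range n, k (σ (a + j)) (σ (a + j + 1)) * L⁻¹) *
      ∏ j ∈ Finset.range (n + 1), w (σ (a + j)))
    (hμ : ∀ (a : ℤ) (n : ℕ) (Φ : (ℤ → S) → ℝ≥0∞), Measurable Φ →
      DependsOn Φ (↑(Finset.Icc a (a + n)) : Set ℤ) → ∀ η : ℤ → S,
        ∫⁻ σ, Φ σ ∂μ = (∫⋯∫⁻_Finset.Icc a (a + n), (fun σ => Φ σ * D a n σ) ∂fun _ : ℤ => ν) η)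
    {v : S → ℝ≥0∞} (hv : Measurable v) (b : ℤ) :
    ∫⁻ σ, v (σ b) ∂μ = ∫⁻ y, v y * (φ y ^ 2 * w y) ∂ν := by
  classical
  set η : ℤ → S := fun _ => Classical.arbitrary S
  have hdep : DependsOn (fun σ : ℤ → S => v (σ b)) (↑(Finset.Icc b (b + ↑(0 : ℕ))) : Set ℤ) := by
    intro x y hxy
    dsimp only
    rw [hxy b (by simp)]
  have hval : ∀ y : S, D b 0 (Function.update η b y) = φ y ^ 2 * w y := fun y => by
    rw [hD]
    simp [sq]
  rw [hμ b 0 (fun σ => v (σ b)) (hv.comp (measurable_pi_apply b)) hdep η]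
  simp only [Nat.cast_zero, add_zero, Finset.Icc_self, lmarginal_singleton, Function.update_self,
    hval]

omit [MeasurableSpace S] in
/-- **One more site**: `D a (m+1)` evaluated at `σ` with `σ_{a+m+1}` replaced by `y` equals
`D a m σ · p(σ_{a+m}, y)` with the transition density `p(x, y) = φ(x)⁻¹ L⁻¹ k(x,y) φ(y) w(y)`.
[folklore] -/
theorem windowDensity_succ_update
    (hD : ∀ a n σ, D a n σ = φ (σ a) * φ (σ (a + n)) *
      (∏ j ∈ Finset.range n, k (σ (a + j)) (σ (a + j + 1)) * L⁻¹) *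
      ∏ j ∈ Finset.range (n + 1), w (σ (a + j)))
    (hp : ∀ x y, p x y = (φ x)⁻¹ * L⁻¹ * k x y * φ y * w y)
    (hφ0 : ∀ z, φ z ≠ 0) (hφt : ∀ z, φ z ≠ ∞)
    (a : ℤ) (m : ℕ) (σ : ℤ → S) (y : S) :
    D a (m + 1) (Function.update σ (a + m + 1) y) = D a m σ * p (σ (a + m)) y := by
  rw [hD, hD, hp]
  have h1 : Function.update σ (a + m + 1) y a = σ a := Function.update_of_ne (by omega) _ _
  have h2 : Function.update σ (a + m + 1) y (a + ↑(m + 1)) = y := by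
    rw [show (a + ↑(m + 1) : ℤ) = a + m + 1 by push_cast; ring]
    exact Function.update_self _ _ _
  have h3 : ∏ j ∈ Finset.range (m + 1), k (Function.update σ (a + m + 1) y (a + j))
      (Function.update σ (a + m + 1) y (a + j + 1)) * L⁻¹ =
      (∏ j ∈ Finset.range m, k (σ (a + j)) (σ (a + j + 1)) * L⁻¹) * (k (σ (a + m)) y * L⁻¹) := by
    rw [Finset.prod_range_succ]
    congr 1
    · refine Finset.prod_congr rfl fun j hj => ?_
      rw [Finset.mem_range] at hj
      rw [Function.update_of_ne (by omega), Function.update_of_ne (by omega)]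
    · rw [Function.update_of_ne (by omega), Function.update_self]
  have h4 : ∏ j ∈ Finset.range (m + 1 + 1), w (Function.update σ (a + m + 1) y (a + j)) =
      (∏ j ∈ Finset.range (m + 1), w (σ (a + j))) * w y := by
    rw [Finset.prod_range_succ]
    congr 1
    · refine Finset.prod_congr rfl fun j hj => ?_
      rw [Finset.mem_range] at hj
      rw [Function.update_of_ne (by omega)]
    · rw [show (a + ↑(m + 1) : ℤ) = a + m + 1 by push_cast; ring, Function.update_self]
  rw [h1, h2, h3, h4]
  have hφφ : φ (σ (a + m)) * (φ (σ (a + m)))⁻¹ = 1 := ENNReal.mul_inv_cancel (hφ0 _) (hφt _)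
  calc φ (σ a) * φ y * ((∏ j ∈ Finset.range m, k (σ (a + j)) (σ (a + j + 1)) * L⁻¹) *
        (k (σ (a + m)) y * L⁻¹)) * ((∏ j ∈ Finset.range (m + 1), w (σ (a + j))) * w y)
      = (φ (σ (a + m)) * (φ (σ (a + m)))⁻¹) * (φ (σ a) * φ y *
          ((∏ j ∈ Finset.range m, k (σ (a + j)) (σ (a + j + 1)) * L⁻¹) * (k (σ (a + m)) y * L⁻¹)) *
          ((∏ j ∈ Finset.range (m + 1), w (σ (a + j))) * w y)) := by rw [hφφ, one_mul]
    _ = _ := by ring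

/-! ### The transition density and the one-step Markov operator -/

/-- The transition density `p(x, y) = φ(x)⁻¹ L⁻¹ k(x,y) φ(y) w(y)` is jointly measurable. [folklore] -/
theorem measurable_transition (hk : Measurable (uncurry k)) (hφ : Measurable φ) (hw : Measurable w)
    (hp : ∀ x y, p x y = (φ x)⁻¹ * L⁻¹ * k x y * φ y * w y) : Measurable (uncurry p) := by
  have h : uncurry p = fun q : S × S => (φ q.1)⁻¹ * L⁻¹ * k q.1 q.2 * φ q.2 * w q.2 :=
    funext fun q => hp q.1 q.2
  rw [h]
  exact ((((hφ.comp measurable_fst).inv.mul_const _).mul hk).mul (hφ.comp measurable_snd)).mul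
    (hw.comp measurable_snd)

/-- The one-step Markov operator `(Pv)(x) = ∫⁻ p(x,y) v(y) dν(y)` preserves measurability, and so
do its iterates. [folklore] -/
theorem measurable_markovOp_iterate [SFinite ν] (hpm : Measurable (uncurry p)) {v : S → ℝ≥0∞}
    (hv : Measurable v) (n : ℕ) :
    Measurable ((fun (u : S → ℝ≥0∞) (x : S) => ∫⁻ y, p x y * u y ∂ν)^[n] v) := by
  induction n with
  | zero => exact hv
  | succ n ih =>
    rw [Function.iterate_succ_apply']
    exact (hpm.mul (ih.comp measurable_snd)).lintegral_prod_right'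

/-- **The transition density is a probability density**: `∫⁻ p(x, y) dν(y) = 1` (the pointwise
eigen-equation `∫ k(x,y) φ(y) w(y) dν(y) = L φ(x)`). [cite: Georgii2011, Thm 10.25 and §11.1] -/
theorem lintegral_transition_eq_one (hk : Measurable (uncurry k)) (hφ : Measurable φ)
    (hw : Measurable w) (hL0 : L ≠ 0) (hLt : L ≠ ∞)
    (heig : ∀ z, ∫⁻ y, k z y * φ y * w y ∂ν = L * φ z)
    (hp : ∀ x y, p x y = (φ x)⁻¹ * L⁻¹ * k x y * φ y * w y)
    (hφ0 : ∀ z, φ z ≠ 0) (hφt : ∀ z, φ z ≠ ∞) (x : S) :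
    ∫⁻ y, p x y ∂ν = 1 := by
  have h : ∀ y, p x y = (φ x)⁻¹ * L⁻¹ * (k x y * φ y * w y) := fun y => by rw [hp]; ring
  have hm : Measurable fun y => k x y * φ y * w y := (hk.of_uncurry_left.mul hφ).mul hw
  simp_rw [h]
  rw [lintegral_const_mul _ hm, heig]
  calc (φ x)⁻¹ * L⁻¹ * (L * φ x) = (L * L⁻¹) * (φ x * (φ x)⁻¹) := by ring
    _ = 1 := by
      rw [ENNReal.mul_inv_cancel hL0 hLt, ENNReal.mul_inv_cancel (hφ0 x) (hφt x), one_mul]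

/-! ### The Markov property for window observables -/

/-- **Markov property, one step.** For a measurable `Φ ≥ 0` depending only on the window
`{a, …, a+m}` and a measurable `v ≥ 0` on `S`,
`∫⁻ Φ(σ) v(σ_{a+m+1}) dμ = ∫⁻ Φ(σ) (Pv)(σ_{a+m}) dμ` with `(Pv)(x) = ∫⁻ p(x,y) v(y) dν(y)`: the
conditional law of the next spin given the past is `p(σ_{a+m}, ·) dν`.
[cite: Georgii2011, Thm 10.25 and §11.1] -/
theorem lintegral_mul_comp_eval_succ [Nonempty S] [SigmaFinite ν]
    (hk : Measurable (uncurry k)) (hφ : Measurable φ) (hw : Measurable w)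
    (hD : ∀ a n σ, D a n σ = φ (σ a) * φ (σ (a + n)) *
      (∏ j ∈ Finset.range n, k (σ (a + j)) (σ (a + j + 1)) * L⁻¹) *
      ∏ j ∈ Finset.range (n + 1), w (σ (a + j)))
    (hp : ∀ x y, p x y = (φ x)⁻¹ * L⁻¹ * k x y * φ y * w y)
    (hφ0 : ∀ z, φ z ≠ 0) (hφt : ∀ z, φ z ≠ ∞)
    (hμ : ∀ (a : ℤ) (n : ℕ) (Φ : (ℤ → S) → ℝ≥0∞), Measurable Φ →
      DependsOn Φ (↑(Finset.Icc a (a + n)) : Set ℤ) → ∀ η : ℤ → S,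
        ∫⁻ σ, Φ σ ∂μ = (∫⋯∫⁻_Finset.Icc a (a + n), (fun σ => Φ σ * D a n σ) ∂fun _ : ℤ => ν) η)
    {Φ : (ℤ → S) → ℝ≥0∞} (hΦm : Measurable Φ) {a : ℤ} {m : ℕ}
    (hΦd : DependsOn Φ (↑(Finset.Icc a (a + m)) : Set ℤ)) {v : S → ℝ≥0∞} (hv : Measurable v) :
    ∫⁻ σ, Φ σ * v (σ (a + m + 1)) ∂μ = ∫⁻ σ, Φ σ * (∫⁻ y, p (σ (a + m)) y * v y ∂ν) ∂μ := by
  classical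
  set η : ℤ → S := fun _ => Classical.arbitrary S
  have hpm : Measurable (uncurry p) := measurable_transition hk hφ hw hp
  have hPm : Measurable fun x => ∫⁻ y, p x y * v y ∂ν :=
    (hpm.mul (hv.comp measurable_snd)).lintegral_prod_right'
  -- both sides through the window formula
  have hmeas1 : Measurable fun σ : ℤ → S => Φ σ * v (σ (a + m + 1)) :=
    hΦm.mul (hv.comp (measurable_pi_apply _))
  have hdep1 : DependsOn (fun σ : ℤ → S => Φ σ * v (σ (a + m + 1)))
      (↑(Finset.Icc a (a + ↑(m + 1))) : Set ℤ) := by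
    intro x y hxy
    dsimp only
    rw [hΦd fun i hi => hxy i ?_, hxy (a + m + 1) ?_]
    · simp only [Finset.coe_Icc, Set.mem_Icc]; push_cast; omega
    · simp only [Finset.coe_Icc, Set.mem_Icc] at hi ⊢; push_cast; omega
  have hmeas2 : Measurable fun σ : ℤ → S => Φ σ * ∫⁻ y, p (σ (a + m)) y * v y ∂ν :=
    hΦm.mul (hPm.comp (measurable_pi_apply _))
  have hdep2 : DependsOn (fun σ : ℤ → S => Φ σ * ∫⁻ y, p (σ (a + m)) y * v y ∂ν)
      (↑(Finset.Icc a (a + m)) : Set ℤ) := by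
    intro x y hxy
    dsimp only
    rw [hΦd hxy, hxy (a + m) (by simp)]
  rw [hμ a (m + 1) (fun σ => Φ σ * v (σ (a + m + 1))) hmeas1 hdep1 η,
    hμ a m (fun σ => Φ σ * ∫⁻ y, p (σ (a + m)) y * v y ∂ν) hmeas2 hdep2 η]
  -- split the window `{a, …, a+m+1} = {a, …, a+m} ∪ {a+m+1}` and integrate the last site first
  have hsplit : Finset.Icc a (a + ↑(m + 1)) = Finset.Icc a (a + m) ∪ {a + m + 1} := by
    ext i
    simp only [Finset.mem_Icc, Finset.mem_union, Finset.mem_singleton]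
    push_cast
    omega
  have hdisj : Disjoint (Finset.Icc a (a + m)) {a + m + 1} := by
    rw [Finset.disjoint_singleton_right, Finset.mem_Icc]
    omega
  have hmeas3 : Measurable fun σ : ℤ → S => Φ σ * v (σ (a + m + 1)) * D a (m + 1) σ :=
    hmeas1.mul (measurable_D hk hφ hw hD _ _)
  rw [hsplit, lmarginal_union _ (fun σ => Φ σ * v (σ (a + m + 1)) * D a (m + 1) σ) hmeas3 hdisj]
  have hfun : (∫⋯∫⁻_({a + m + 1} : Finset ℤ),
      (fun σ => Φ σ * v (σ (a + m + 1)) * D a (m + 1) σ) ∂fun _ : ℤ => ν) =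
      fun x => Φ x * (∫⁻ y, p (x (a + m)) y * v y ∂ν) * D a m x := by
    funext x
    rw [lmarginal_singleton]
    dsimp only
    have hΦx : ∀ y, Φ (Function.update x (a + m + 1) y) = Φ x := fun y =>
      hΦd fun i hi => Function.update_of_ne (by
        simp only [Finset.coe_Icc, Set.mem_Icc] at hi; omega) _ _
    simp_rw [hΦx, Function.update_self, windowDensity_succ_update hD hp hφ0 hφt a m x]
    have h2 : ∀ y, Φ x * v y * (D a m x * p (x (a + m)) y) =
        Φ x * D a m x * (p (x (a + m)) y * v y) := fun y => by ring
    have hm : Measurable fun y => p (x (a + m)) y * v y := hpm.of_uncurry_left.mul hv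
    simp_rw [h2]
    rw [lintegral_const_mul _ hm]
    ring
  rw [hfun]

/-- **Markov property, `n` steps.** For a measurable `Φ ≥ 0` depending only on `{a, …, a+m}`
and a measurable `v ≥ 0`, `∫⁻ Φ(σ) v(σ_{a+m+n}) dμ = ∫⁻ Φ(σ) (Pⁿv)(σ_{a+m}) dμ`, `Pⁿ` the `n`-th
iterate of `(Pu)(x) = ∫⁻ p(x,y) u(y) dν(y)`. [cite: Georgii2011, Thm 10.25 and §11.1] -/
theorem lintegral_mul_comp_eval_add [Nonempty S] [SigmaFinite ν]
    (hk : Measurable (uncurry k)) (hφ : Measurable φ) (hw : Measurable w)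
    (hD : ∀ a n σ, D a n σ = φ (σ a) * φ (σ (a + n)) *
      (∏ j ∈ Finset.range n, k (σ (a + j)) (σ (a + j + 1)) * L⁻¹) *
      ∏ j ∈ Finset.range (n + 1), w (σ (a + j)))
    (hp : ∀ x y, p x y = (φ x)⁻¹ * L⁻¹ * k x y * φ y * w y)
    (hφ0 : ∀ z, φ z ≠ 0) (hφt : ∀ z, φ z ≠ ∞)
    (hμ : ∀ (a : ℤ) (n : ℕ) (Φ : (ℤ → S) → ℝ≥0∞), Measurable Φ →
      DependsOn Φ (↑(Finset.Icc a (a + n)) : Set ℤ) → ∀ η : ℤ → S,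
        ∫⁻ σ, Φ σ ∂μ = (∫⋯∫⁻_Finset.Icc a (a + n), (fun σ => Φ σ * D a n σ) ∂fun _ : ℤ => ν) η)
    {Φ : (ℤ → S) → ℝ≥0∞} (hΦm : Measurable Φ) {a : ℤ} {m : ℕ}
    (hΦd : DependsOn Φ (↑(Finset.Icc a (a + m)) : Set ℤ)) (n : ℕ) {v : S → ℝ≥0∞}
    (hv : Measurable v) :
    ∫⁻ σ, Φ σ * v (σ (a + m + n)) ∂μ =
      ∫⁻ σ, Φ σ * ((fun (u : S → ℝ≥0∞) (x : S) => ∫⁻ y, p x y * u y ∂ν)^[n] v) (σ (a + m)) ∂μ := by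
  have hpm : Measurable (uncurry p) := measurable_transition hk hφ hw hp
  induction n generalizing v with
  | zero => simp
  | succ n ih =>
    have hΦd' : DependsOn Φ (↑(Finset.Icc a (a + ↑(m + n))) : Set ℤ) := hΦd.mono fun i hi => by
      simp only [Finset.coe_Icc, Set.mem_Icc] at hi ⊢; push_cast; omega
    have h1 : ∫⁻ σ, Φ σ * v (σ (a + m + ↑(n + 1))) ∂μ = ∫⁻ σ, Φ σ * v (σ (a + ↑(m + n) + 1)) ∂μ := by
      refine lintegral_congr fun σ => ?_
      rw [show (a + ↑m + ↑(n + 1) : ℤ) = a + ↑(m + n) + 1 by push_cast; ring]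
    have hPv : Measurable fun x => ∫⁻ y, p x y * v y ∂ν :=
      (hpm.mul (hv.comp measurable_snd)).lintegral_prod_right'
    rw [h1, lintegral_mul_comp_eval_succ hk hφ hw hD hp hφ0 hφt hμ hΦm hΦd' hv,
      show (a + ↑(m + n) : ℤ) = a + m + n by push_cast; ring, ih hPv, Function.iterate_succ_apply]

end Chain

end Literature.Probability.LatticeModels

end
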